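import Literature.NumberTheory.NumberFields.BhargavaQuinticSpaceOrbit
import Mathlib.LinearAlgebra.Vandermonde
import Mathlib.FieldTheory.IsAlgClosed.Basic
import Mathlib.FieldTheory.Separable
import Mathlib.Tactic.ComputeDegree
import HarnessLib

/-!
# Bhargava's quintic space: the explicit non-degenerate section `f ↦ A_f`

Support file for the named fact
`Literature.NumberTheory.NumberFields.BhargavaQuinticSpace.WrightYukie1992_orbit_bijective_etaleQuintic`
(file `BhargavaQuinticSpace.lean`), towards part (c) (every étale quintic algebra arises).
Everything here is PROVED.

For a monic quintic `f = T⁵ + a T⁴ + b T³ + c T² + d T + e` over a commutative ring `R` we write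
down an explicit `A_f = (A₁, …, A₄) ∈ V(R) = R⁴ ⊗ ∧²R⁵` (`sectionQuintic a b c d e`) whose pencil
`A_f(t) = ∑ tᵢ Aᵢ` is the alternating `5 × 5` matrix of linear forms (`pencil_sectionQuintic`)

    [   0     ℓ    a t₃  -t₃   t₂ ]
    [  -ℓ     0     t₃    t₂  -t₁ ]        ℓ = e t₀ + d t₁ + c t₂ + b t₃,
    [ -a t₃  -t₃    0    -t₁   t₀ ]
    [  t₃    -t₂    t₁    0    0  ]
    [ -t₂     t₁   -t₀    0    0  ]

the Buchsbaum–Eisenbud (skew) syzygy matrix of the five quadrics through the five points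
`[1 : θ : θ² : θ³]` (`f(θ) = 0`) on the twisted cubic; indeed its signed `4 × 4` sub-Pfaffians are
(`subPfaffian_sectionQuintic_zero` … `_four`)

    Q(A_f(t)) = -( t₀t₂ - t₁²,  t₀t₃ - t₁t₂,  t₁t₃ - t₂²,  q₁,  q₂ ),
    q₁ = t₂t₃ + a t₁t₃ + b t₀t₃ + c t₀t₂ + d t₀t₁ + e t₀²,   q₂ = t₃² + a t₂t₃ + b t₁t₃ + c t₁t₂ + d t₁² + e t₀t₁,

i.e. minus the three `2 × 2` minors of `[[t₀,t₁,t₂],[t₁,t₂,t₃]]` (cutting out the twisted cubic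
`(s³, s²u, su², u³)`) and two quadrics restricting to `s·F(s,u)` and `u·F(s,u)` on it (`F` the
homogenisation of `f`).  Consequences, over a field `k`:

* `geomZeroLocus_sectionQuintic`: `Z_{A_f}(k̄) = {[1 : θ : θ² : θ³] : f(θ) = 0}` exactly;
* `isNondegenerate_sectionQuintic`: for `f` separable, `A_f` is NON-DEGENERATE — five points
  (`ncard = 5`), in general position (Vandermonde), and the five quadrics are linearly independent
  (evaluation at five integer points).

This is the classical fact that `n + 2` points in general position in `ℙⁿ` are cut out by the
quadrics through them and lie on a rational normal curve, made explicit for `n = 3`; it realises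
Bhargava's correspondence `A ↦ (X, the five points)` [Bhargava2008, §2 pp. 62–63] on the twisted
cubic model.  It is the `k`-rational SECTION used for part (c) of the fact (Wright–Yukie: "all such
fields arise", [Yukie1993, §0.4]).

## References

* M. Bhargava, *Higher composition laws IV*, Ann. of Math. 167 (2008), 53–94, §2. [Bhargava2008]
* A. Yukie, *Shintani Zeta Functions*, LMS LNS 183, CUP (1993), §0.4. [Yukie1993]
-/

noncomputable section

open Matrix Polynomial
open scoped LinearAlgebra.Projectivization

namespace Literature.NumberTheory.NumberFields
namespace BhargavaQuinticSpace

universe u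

variable {R : Type*} [CommRing R]

/-! ### The explicit section `f ↦ A_f` -/

/-- `altFive …` is alternating. [folklore] -/
theorem altFive_mem_altMatrix (a b c d e f g p q r : R) :
    altFive a b c d e f g p q r ∈ altMatrix (Fin 5) R := by
  refine ⟨?_, fun i => ?_⟩
  · ext i j
    fin_cases i <;> fin_cases j <;> simp [altFive]
  · fin_cases i <;> simp [altFive]

/-- **The section `A_f`.** The element `A_f = (A₁, A₂, A₃, A₄) ∈ V(R)` attached to the monic quintic
`f = T⁵ + a T⁴ + b T³ + c T² + d T + e`: `A₁ = e E₀₁ + E₂₄`, `A₂ = d E₀₁ - E₁₄ - E₂₃`,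
`A₃ = c E₀₁ + E₀₄ + E₁₃`, `A₄ = b E₀₁ + a E₀₂ - E₀₃ + E₁₂` (`Eᵢⱼ = eᵢ ∧ eⱼ`), the coefficients of the
Buchsbaum–Eisenbud syzygy matrix of the five points `[1 : θ : θ² : θ³]`, `f(θ) = 0`.
[cite: Bhargava2008, §2 pp. 62–63] -/
def sectionQuintic (a b c d e : R) : BhargavaQuinticSpace R :=
  ![⟨altFive e 0 0 0 0 0 0 0 1 0, altFive_mem_altMatrix _ _ _ _ _ _ _ _ _ _⟩,
    ⟨altFive d 0 0 0 0 0 (-1) (-1) 0 0, altFive_mem_altMatrix _ _ _ _ _ _ _ _ _ _⟩,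
    ⟨altFive c 0 0 1 0 1 0 0 0 0, altFive_mem_altMatrix _ _ _ _ _ _ _ _ _ _⟩,
    ⟨altFive b a (-1) 0 1 0 0 0 0 0, altFive_mem_altMatrix _ _ _ _ _ _ _ _ _ _⟩]

/-- The monic quintic `f = T⁵ + a T⁴ + b T³ + c T² + d T + e`. [folklore] -/
def quinticPoly (a b c d e : R) : R[X] :=
  X ^ 5 + C a * X ^ 4 + C b * X ^ 3 + C c * X ^ 2 + C d * X + C e

/-- Evaluation of the quintic: `f(θ) = θ⁵ + a θ⁴ + b θ³ + c θ² + d θ + e`. [folklore] -/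
theorem aeval_quinticPoly {S : Type*} [CommRing S] [Algebra R S] (a b c d e : R) (θ : S) :
    aeval θ (quinticPoly a b c d e) =
      θ ^ 5 + algebraMap R S a * θ ^ 4 + algebraMap R S b * θ ^ 3 + algebraMap R S c * θ ^ 2 +
        algebraMap R S d * θ + algebraMap R S e := by
  simp [quinticPoly]

/-- `deg f = 5`. [folklore] -/
theorem natDegree_quinticPoly [Nontrivial R] (a b c d e : R) : (quinticPoly a b c d e).natDegree = 5 := by
  unfold quinticPoly
  compute_degree!

/-- `f ≠ 0`. [folklore] -/
theorem quinticPoly_ne_zero [Nontrivial R] (a b c d e : R) : quinticPoly a b c d e ≠ 0 := by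
  intro h
  have := natDegree_quinticPoly a b c d e
  rw [h, natDegree_zero] at this
  exact absurd this (by norm_num)

/-- Base change of the quintic. [folklore] -/
theorem map_quinticPoly {S : Type*} [CommRing S] (φ : R →+* S) (a b c d e : R) :
    (quinticPoly a b c d e).map φ = quinticPoly (φ a) (φ b) (φ c) (φ d) (φ e) := by
  simp [quinticPoly, Polynomial.map_pow]

/-- The pencil `A_f(t) = ∑ tᵢ Aᵢ` of the section: the Buchsbaum–Eisenbud (skew) syzygy matrix of the
five quadrics through five points of the twisted cubic (see the module docstring).
[cite: Bhargava2008, §2 pp. 62–63] -/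
theorem pencil_sectionQuintic (a b c d e : R) (t : Fin 4 → R) :
    pencil (sectionQuintic a b c d e) t =
      altFive (e * t 0 + d * t 1 + c * t 2 + b * t 3) (a * t 3) (-t 3) (t 2) (t 3) (t 2) (-t 1)
        (-t 1) (t 0) 0 := by
  ext i j
  simp only [pencil, Fin.sum_univ_four, sectionQuintic, Matrix.add_apply, Matrix.smul_apply,
    smul_eq_mul]
  fin_cases i <;> fin_cases j <;> simp [altFive] <;> ring

/-- `Q₁(A_f)(t) = -(t₀t₂ - t₁²)`. [cite: Bhargava2008, §2 pp. 62–63] -/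
theorem subPfaffian_sectionQuintic_zero (a b c d e : R) (t : Fin 4 → R) :
    subPfaffian (sectionQuintic a b c d e) 0 t = -(t 0 * t 2 - t 1 * t 1) := by
  rw [subPfaffian, pencil_sectionQuintic, subPfVec_apply_zero]
  simp [altFive]
  ring

/-- `Q₂(A_f)(t) = -(t₀t₃ - t₁t₂)`. [cite: Bhargava2008, §2 pp. 62–63] -/
theorem subPfaffian_sectionQuintic_one (a b c d e : R) (t : Fin 4 → R) :
    subPfaffian (sectionQuintic a b c d e) 1 t = -(t 0 * t 3 - t 1 * t 2) := by
  rw [subPfaffian, pencil_sectionQuintic, subPfVec_apply_one]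
  simp [altFive]
  ring

/-- `Q₃(A_f)(t) = -(t₁t₃ - t₂²)`. [cite: Bhargava2008, §2 pp. 62–63] -/
theorem subPfaffian_sectionQuintic_two (a b c d e : R) (t : Fin 4 → R) :
    subPfaffian (sectionQuintic a b c d e) 2 t = -(t 1 * t 3 - t 2 * t 2) := by
  rw [subPfaffian, pencil_sectionQuintic, subPfVec_apply_two]
  simp [altFive]
  ring

/-- `Q₄(A_f)(t) = -q₁(t) = -(t₂t₃ + a t₁t₃ + b t₀t₃ + c t₀t₂ + d t₀t₁ + e t₀²)`.
[cite: Bhargava2008, §2 pp. 62–63] -/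
theorem subPfaffian_sectionQuintic_three (a b c d e : R) (t : Fin 4 → R) :
    subPfaffian (sectionQuintic a b c d e) 3 t =
      -(t 2 * t 3 + a * (t 1 * t 3) + b * (t 0 * t 3) + c * (t 0 * t 2) + d * (t 0 * t 1) +
        e * (t 0 * t 0)) := by
  rw [subPfaffian, pencil_sectionQuintic, subPfVec_apply_three]
  simp [altFive]
  ring

/-- `Q₅(A_f)(t) = -q₂(t) = -(t₃² + a t₂t₃ + b t₁t₃ + c t₁t₂ + d t₁² + e t₀t₁)`.
[cite: Bhargava2008, §2 pp. 62–63] -/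
theorem subPfaffian_sectionQuintic_four (a b c d e : R) (t : Fin 4 → R) :
    subPfaffian (sectionQuintic a b c d e) 4 t =
      -(t 3 * t 3 + a * (t 2 * t 3) + b * (t 1 * t 3) + c * (t 1 * t 2) + d * (t 1 * t 1) +
        e * (t 0 * t 1)) := by
  rw [subPfaffian, pencil_sectionQuintic, subPfVec_apply_four]
  simp [altFive]
  ring

/-- The section commutes with base change. [folklore] -/
theorem map_sectionQuintic {S : Type*} [CommRing S] (φ : R →+* S) (a b c d e : R) :
    map φ (sectionQuintic a b c d e) = sectionQuintic (φ a) (φ b) (φ c) (φ d) (φ e) := by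
  funext i
  apply Subtype.ext
  rw [coe_map_apply]
  fin_cases i <;>
  · ext p q
    fin_cases p <;> fin_cases q <;> simp [sectionQuintic, altFive]

/-! ### The zero locus of the section: five points on the twisted cubic -/

section FieldK

variable {K : Type*} [Field K]

/-- The point `(1, θ, θ², θ³)` of the affine cone over the twisted cubic. [folklore] -/
def twistedCubicPt (θ : K) : Fin 4 → K := ![1, θ, θ ^ 2, θ ^ 3]

/-- Coordinate `0` of `(1, θ, θ², θ³)`. [folklore] -/
@[simp] theorem twistedCubicPt_zero (θ : K) : twistedCubicPt θ 0 = 1 := rfl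
/-- Coordinate `1` of `(1, θ, θ², θ³)`. [folklore] -/
@[simp] theorem twistedCubicPt_one (θ : K) : twistedCubicPt θ 1 = θ := rfl
/-- Coordinate `2` of `(1, θ, θ², θ³)`. [folklore] -/
@[simp] theorem twistedCubicPt_two (θ : K) : twistedCubicPt θ 2 = θ ^ 2 := rfl
/-- Coordinate `3` of `(1, θ, θ², θ³)`. [folklore] -/
@[simp] theorem twistedCubicPt_three (θ : K) : twistedCubicPt θ 3 = θ ^ 3 := rfl

/-- `(1, θ, θ², θ³) ≠ 0`. [folklore] -/
theorem twistedCubicPt_ne_zero (θ : K) : twistedCubicPt θ ≠ 0 :=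
  fun h => one_ne_zero (congrFun h 0)

/-- `θ ↦ (1, θ, θ², θ³)` is injective. [folklore] -/
theorem twistedCubicPt_injective : Function.Injective (twistedCubicPt (K := K)) :=
  fun _ _ h => congrFun h 1

/-- The five quadrics of `A_f` vanish at `s • (1, θ, θ², θ³)` iff `s = 0` or `f(θ) = 0`
(on the twisted cubic `q₁ = s F(s,u)`, `q₂ = u F(s,u)`). [folklore] -/
theorem forall_subPfaffian_sectionQuintic_smul_twistedCubicPt (a b c d e s θ : K) :
    (∀ i, subPfaffian (sectionQuintic a b c d e) i (s • twistedCubicPt θ) = 0) ↔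
      s = 0 ∨ θ ^ 5 + a * θ ^ 4 + b * θ ^ 3 + c * θ ^ 2 + d * θ + e = 0 := by
  constructor
  · intro h
    have h3 := h 3
    rw [subPfaffian_sectionQuintic_three] at h3
    simp only [Pi.smul_apply, twistedCubicPt_zero, twistedCubicPt_one, twistedCubicPt_two,
      twistedCubicPt_three, smul_eq_mul] at h3
    have : s ^ 2 * (θ ^ 5 + a * θ ^ 4 + b * θ ^ 3 + c * θ ^ 2 + d * θ + e) = 0 := by
      linear_combination -h3
    rcases mul_eq_zero.mp this with hs | hf
    · exact Or.inl (pow_eq_zero_iff (by norm_num) |>.mp hs)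
    · exact Or.inr hf
  · intro h
    have c0 : subPfaffian (sectionQuintic a b c d e) 0 (s • twistedCubicPt θ) = 0 := by
      rw [subPfaffian_sectionQuintic_zero]
      simp
      ring
    have c1 : subPfaffian (sectionQuintic a b c d e) 1 (s • twistedCubicPt θ) = 0 := by
      rw [subPfaffian_sectionQuintic_one]
      simp
      ring
    have c2 : subPfaffian (sectionQuintic a b c d e) 2 (s • twistedCubicPt θ) = 0 := by
      rw [subPfaffian_sectionQuintic_two]
      simp
      ring
    have c3 : subPfaffian (sectionQuintic a b c d e) 3 (s • twistedCubicPt θ) = 0 := by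
      rw [subPfaffian_sectionQuintic_three]
      simp only [Pi.smul_apply, twistedCubicPt_zero, twistedCubicPt_one, twistedCubicPt_two,
        twistedCubicPt_three, smul_eq_mul]
      rcases h with hs | hf
      · simp [hs]
      · linear_combination -(s ^ 2) * hf
    have c4 : subPfaffian (sectionQuintic a b c d e) 4 (s • twistedCubicPt θ) = 0 := by
      rw [subPfaffian_sectionQuintic_four]
      simp only [Pi.smul_apply, twistedCubicPt_zero, twistedCubicPt_one, twistedCubicPt_two,
        twistedCubicPt_three, smul_eq_mul]
      rcases h with hs | hf
      · simp [hs]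
      · linear_combination -(s ^ 2 * θ) * hf
    intro i
    fin_cases i
    exacts [c0, c1, c2, c3, c4]

/-- A non-zero common zero of the five quadrics of `A_f` lies on the affine cone over the twisted
cubic, at a root of `f` (the case `t₀ = 0` forces `t = 0`). [folklore] -/
theorem exists_eq_smul_twistedCubicPt (a b c d e : K) {v : Fin 4 → K} (hv : v ≠ 0)
    (h : ∀ i, subPfaffian (sectionQuintic a b c d e) i v = 0) :
    ∃ s θ : K, s ≠ 0 ∧ v = s • twistedCubicPt θ ∧
      θ ^ 5 + a * θ ^ 4 + b * θ ^ 3 + c * θ ^ 2 + d * θ + e = 0 := by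
  have h0 := h 0
  have h1 := h 1
  have h2 := h 2
  have h4 := h 4
  rw [subPfaffian_sectionQuintic_zero] at h0
  rw [subPfaffian_sectionQuintic_one] at h1
  rw [subPfaffian_sectionQuintic_two] at h2
  rw [subPfaffian_sectionQuintic_four] at h4
  by_cases hv0 : v 0 = 0
  · exfalso
    apply hv
    have hv1 : v 1 = 0 := by
      have : v 1 * v 1 = 0 := by linear_combination h0 + v 2 * hv0
      exact mul_self_eq_zero.mp this
    have hv2 : v 2 = 0 := by
      have : v 2 * v 2 = 0 := by linear_combination h2 + v 3 * hv1
      exact mul_self_eq_zero.mp this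
    have hv3 : v 3 = 0 := by
      have : v 3 * v 3 = 0 := by
        linear_combination -h4 - (a * v 3 + c * v 1) * hv2 - (b * v 3 + d * v 1 + e * v 0) * hv1
      exact mul_self_eq_zero.mp this
    funext i
    fin_cases i <;> assumption
  · set θ := v 1 / v 0 with hθ
    have hv1 : v 1 = v 0 * θ := by rw [hθ]; field_simp
    have hv2 : v 2 = v 0 * θ ^ 2 := by
      have e2 : v 0 * v 2 = v 1 * v 1 := by linear_combination -h0
      have : v 2 = v 1 * v 1 / v 0 := by field_simp; linear_combination e2
      rw [this, hv1]
      field_simp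
    have hv3 : v 3 = v 0 * θ ^ 3 := by
      have e3 : v 0 * v 3 = v 1 * v 2 := by linear_combination -h1
      have : v 3 = v 1 * v 2 / v 0 := by field_simp; linear_combination e3
      rw [this, hv1, hv2]
      field_simp
    have hveq : v = v 0 • twistedCubicPt θ := by
      funext i
      fin_cases i
      · simp
      · simpa using hv1
      · simpa using hv2
      · simpa using hv3
    refine ⟨v 0, θ, hv0, hveq, ?_⟩
    rw [hveq] at h
    rcases (forall_subPfaffian_sectionQuintic_smul_twistedCubicPt a b c d e (v 0) θ).mp h with hs | hf
    · exact absurd hs hv0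
    · exact hf

end FieldK

/-! ### Non-degeneracy of the section over a field `k` -/

section Fieldk

variable (k : Type u) [Field k]

/-- The point `[1 : θ : θ² : θ³] ∈ ℙ³(k̄)` of the twisted cubic. [folklore] -/
def twistedCubicProj (θ : AlgebraicClosure k) : ℙ (AlgebraicClosure k) (Fin 4 → AlgebraicClosure k) :=
  Projectivization.mk _ (twistedCubicPt θ) (twistedCubicPt_ne_zero θ)

/-- `θ ↦ [1 : θ : θ² : θ³]` is injective. [folklore] -/
theorem twistedCubicProj_injective : Function.Injective (twistedCubicProj k) := by
  intro θ θ' h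
  rw [twistedCubicProj, twistedCubicProj, Projectivization.mk_eq_mk_iff'] at h
  obtain ⟨s, hs⟩ := h
  have h0 := congrFun hs 0
  have h1 := congrFun hs 1
  simp only [Pi.smul_apply, twistedCubicPt_zero, smul_eq_mul, mul_one] at h0
  simp only [Pi.smul_apply, twistedCubicPt_one, smul_eq_mul, h0, one_mul] at h1
  exact h1.symm

/-- Base change of `A_f` to `k̄` is `A_{f̄}`. [folklore] -/
theorem baseChange_sectionQuintic (a b c d e : k) :
    baseChange k (sectionQuintic a b c d e) =
      sectionQuintic (algebraMap k _ a) (algebraMap k _ b) (algebraMap k _ c) (algebraMap k _ d)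
        (algebraMap k _ e) :=
  map_sectionQuintic _ a b c d e

/-- **The zero locus of the section**: `Z_{A_f}(k̄) = {[1 : θ : θ² : θ³] : θ ∈ k̄, f(θ) = 0}`.
[cite: Bhargava2008, §2 pp. 62–63] -/
theorem geomZeroLocus_sectionQuintic (a b c d e : k) :
    geomZeroLocus k (sectionQuintic a b c d e) =
      twistedCubicProj k '' ((quinticPoly a b c d e).rootSet (AlgebraicClosure k)) := by
  ext p
  induction p using Projectivization.ind with
  | h v hv =>
    rw [mk_mem_geomZeroLocus_iff, baseChange_sectionQuintic, Set.mem_image]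
    constructor
    · intro h
      obtain ⟨s, θ, hs, hveq, hf⟩ := exists_eq_smul_twistedCubicPt _ _ _ _ _ hv h
      refine ⟨θ, ?_, ?_⟩
      · rw [Polynomial.mem_rootSet_of_ne (quinticPoly_ne_zero a b c d e), aeval_quinticPoly]
        exact hf
      · rw [twistedCubicProj, Projectivization.mk_eq_mk_iff']
        exact ⟨s⁻¹, by rw [hveq, smul_smul, inv_mul_cancel₀ hs, one_smul]⟩
    · rintro ⟨θ, hθ, hθeq⟩
      rw [twistedCubicProj, Projectivization.mk_eq_mk_iff'] at hθeq
      obtain ⟨r, hr⟩ := hθeq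
      have hr0 : r ≠ 0 := by
        rintro rfl
        rw [zero_smul] at hr
        exact twistedCubicPt_ne_zero θ hr.symm
      have hv' : v = r⁻¹ • twistedCubicPt θ := by
        rw [← hr, smul_smul, inv_mul_cancel₀ hr0, one_smul]
      rw [hv']
      rw [Polynomial.mem_rootSet_of_ne (quinticPoly_ne_zero a b c d e), aeval_quinticPoly] at hθ
      exact (forall_subPfaffian_sectionQuintic_smul_twistedCubicPt (algebraMap k _ a)
        (algebraMap k _ b) (algebraMap k _ c) (algebraMap k _ d) (algebraMap k _ e) r⁻¹ θ).mpr
        (Or.inr hθ)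

/-- For separable `f`, the zero locus of `A_f` has exactly five geometric points. [folklore] -/
theorem ncard_geomZeroLocus_sectionQuintic (a b c d e : k) (hsep : (quinticPoly a b c d e).Separable) :
    (geomZeroLocus k (sectionQuintic a b c d e)).ncard = 5 := by
  classical
  rw [geomZeroLocus_sectionQuintic, Set.ncard_image_of_injective _ (twistedCubicProj_injective k),
    Set.ncard_eq_toFinset_card', Set.toFinset_card,
    Polynomial.card_rootSet_eq_natDegree hsep (IsAlgClosed.splits _), natDegree_quinticPoly]

/-- Four points of the twisted cubic with distinct parameters are projectively independent
(Vandermonde). [folklore] -/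
theorem independent_twistedCubicProj {θ : Fin 4 → AlgebraicClosure k} (hθ : Function.Injective θ) :
    Projectivization.Independent fun i => twistedCubicProj k (θ i) := by
  have hli : LinearIndependent (AlgebraicClosure k) fun i => twistedCubicPt (θ i) := by
    have hV : (fun i => twistedCubicPt (θ i)) = fun i => Matrix.vandermonde θ i := by
      funext i j
      fin_cases j <;> simp [Matrix.vandermonde_apply, twistedCubicPt]
    rw [hV]
    exact Matrix.linearIndependent_rows_iff_isUnit.mpr
      ((Matrix.isUnit_iff_isUnit_det _).mpr
        (Ne.isUnit (Matrix.det_vandermonde_ne_zero_iff.mpr hθ)))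
  exact Projectivization.Independent.mk _ _ hli

/-- The zero locus of `A_f` is in general position (no four of its points are coplanar). [folklore] -/
theorem inGeneralPosition_geomZeroLocus_sectionQuintic (a b c d e : k) :
    InGeneralPosition (geomZeroLocus k (sectionQuintic a b c d e)) := by
  intro φ hφ hmem
  rw [geomZeroLocus_sectionQuintic] at hmem
  choose θ hθroot hθeq using hmem
  have hφeq : φ = fun i => twistedCubicProj k (θ i) := funext fun i => (hθeq i).symm
  have hθinj : Function.Injective θ := by
    intro i j hij
    apply hφ
    rw [← hθeq i, ← hθeq j, hij]
  rw [hφeq]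
  exact independent_twistedCubicProj k hθinj

/-- The five quadrics of `A_f` are linearly independent (over any field), witnessed by evaluation
at the five points `e₁, e₂, e₃, e₁ + e₂, e₂ + e₃`. [folklore] -/
theorem linearIndependent_subPfaffian_sectionQuintic {K : Type*} [Field K] (a b c d e : K) :
    LinearIndependent K
      (fun i : Fin 5 => (subPfaffian (sectionQuintic a b c d e) i : (Fin 4 → K) → K)) := by
  rw [Fintype.linearIndependent_iff]
  intro g hg i
  have ev : ∀ t : Fin 4 → K, ∑ j, g j * subPfaffian (sectionQuintic a b c d e) j t = 0 := by
    intro t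
    simpa using congrFun hg t
  have e1 := ev ![0, 1, 0, 0]
  have e2 := ev ![0, 0, 1, 0]
  have e3 := ev ![0, 0, 0, 1]
  have e4 := ev ![0, 1, 1, 0]
  have e5 := ev ![0, 0, 1, 1]
  simp only [Fin.sum_univ_five, subPfaffian_sectionQuintic_zero, subPfaffian_sectionQuintic_one,
    subPfaffian_sectionQuintic_two, subPfaffian_sectionQuintic_three,
    subPfaffian_sectionQuintic_four] at e1 e2 e3 e4 e5
  simp at e1 e2 e3 e4 e5
  have g4 : g 4 = 0 := by linear_combination e3
  have g2 : g 2 = 0 := by linear_combination e2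
  have g0 : g 0 = 0 := by linear_combination e1 + d * g4
  have g1 : g 1 = 0 := by linear_combination e4 - g0 - g2 + (c + d) * g4
  have g3 : g 3 = 0 := by linear_combination -e5 + g2 - (1 + a) * g4
  fin_cases i <;> assumption

/-- **The section is non-degenerate**: for `f` a separable monic quintic over a field `k`, the
element `A_f ∈ V(k)` is non-degenerate (`IsNondegenerate`). [cite: Bhargava2008, §2 pp. 62–63; Yukie1993, §0.4] -/
theorem isNondegenerate_sectionQuintic (a b c d e : k) (hsep : (quinticPoly a b c d e).Separable) :
    IsNondegenerate k (sectionQuintic a b c d e) := by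
  refine ⟨?_, ncard_geomZeroLocus_sectionQuintic k a b c d e hsep,
    inGeneralPosition_geomZeroLocus_sectionQuintic k a b c d e⟩
  rw [baseChange_sectionQuintic]
  exact linearIndependent_subPfaffian_sectionQuintic _ _ _ _ _

end Fieldk

end BhargavaQuinticSpace
end Literature.NumberTheory.NumberFields
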